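import Literature.AlgebraicGeometry.ComplexMultiplication.EndomorphismFieldNondegenerateType
import Literature.AlgebraicGeometry.ComplexMultiplication.CMTypeEigenlineCriterion
import Literature.AlgebraicGeometry.Pohlmann1968.SimpleCMAbelianVarietyHazamaCriterion
import HarnessLib

/-!
# `dim MT(A) = Rank(Φ)` for a pair `(A, ι : F →+* End_ℚ(A))`, `F` a CM field of degree `2 dim A`, read on THE type

Topic `Literature/AlgebraicGeometry/ComplexMultiplication` (family `hodge`, lane `lit-hodgefound`; the ALGEBRAIC
carrier `Motives.AbelianVariety ℂ`).  Sequel of `EndomorphismFieldNondegenerateType` (`A ∼ A_Φ`, the variety of record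
of THE type `Φ = cmTypeOfPair ιF hF`, which carries a realisation of `Φ` read on `H¹`; Hazama's criterion for the
pair).  The tree proves «`rank(K, S) := dim MT(A)`» (Gordon 1999, 9.1; Pohlmann; Deligne 1982 I Ex. 3.7 (c)) as the
theorem `HodgeStructure.mtRank_bettiHodge_eq_cmTypeRank'` on REALISATIONS `IsCMTypeRealisation Φ A ι θ` (an integral
action with the type read on `H¹`), and the Mumford–Tate rank of `H¹` is an isogeny invariant
(`Pohlmann1968.mtRank_hodge_one_eq_of_isIsogenous`).  This file reads both on Pohlmann's own hypothesis — a CM field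
`F ⊆ End_ℚ(A)` of degree `2 dim A`, i.e. Shimura's pair — with THE type of the pair:

* **`mtRank_hodge_one_eq_cmTypeRank`** — `dim MT(H¹(A)) = Rank(cmTypeOfPair ιF hF)` for EVERY such pair (simple
  or not);
* `mtRank_hodge_one_le_dim_add_one` — Kubota's bound `dim MT(H¹(A)) ≤ dim A + 1` (`MT ⊆ L(A)`, Milne 1999 Prop. 2.5;
  Dodson Thm. 1.0 (ii));
* **`mtRank_hodge_one_eq_dim_add_one_iff`** — `dim MT(H¹(A)) = dim A + 1` iff THE type is nondegenerate (Gordon 9.4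
  / 2.13: `dim Hg(A) = dim A`);
* **`isStablyNondegenerate_of_mtRank_hodge_one_eq`** — Gordon Thm. 6.4's «`dim Hg(A) = dim A ⟹ Hdg(Aⁿ) = Div(Aⁿ)`
  for all `n`» WITHOUT the simplicity hypothesis (for an isotypic `A ∼ B^h` with complex multiplication by the
  field `F`), and the Hodge conjecture for every power (`hodgeConjectureFor_powSucc_of_mtRank_hodge_one_eq`);
* **`isStablyNondegenerate_iff_mtRank_hodge_one_eq_of_isSimple`** — HAZAMA'S CRITERION in Mumford–Tate form for a
  SIMPLE `A` (the tree's `Pohlmann1968.forall_isDivisorGenerated_powSucc_iff_mtRank_eq` is the same statement on the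
  carrier `Milne1999.IsOfCMType X`; here on the pair, read through `EndomorphismFieldNondegenerateType`);
* `isOfCMType` — the pair makes `A` of CM type in Milne's étale sense (re-export of the tree's
  `isOfCMType_of_ringHom`, so that the `IsOfCMType` library — Ribet/Dodson lower bounds
  `Pohlmann1968.four_mul_dim_le_two_pow_mtRank`, `add_one_le_mtRank_of_prime_dvd`, … — applies to the pair).

PRINTED STATEMENTS.  B. B. Gordon, *A survey of the Hodge conjecture for abelian varieties* (1999; held text
`paper:arxiv-alg-geom_9709030`): **9.1** «Let `(K, S)` be a CM-type, `A` a corresponding abelian variety … the rank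
of `(K, S)` is defined by `rank(K,S) := dim MT(A)`» with Pohlmann's computation of `MT(A)`; **9.4** «a CM-type
`(K, S)` is said to be nondegenerate if `rank(K, S) = dim A + 1`»; **2.13** (`dim Hg(A) ≤ dim A` for CM `A`, with
equality iff nondegenerate); **Thm. 6.4** (Hazama).  P. Deligne, *Hodge cycles on abelian varieties* (LNM 900, 1982),
I Ex. 3.7 (c).  T. Kubota, Trans. AMS 118 (1965), §2 («`rank (F; {φᵢ}) ≤ m + 1`»).

The Hodge structure on `H¹(A(ℂ); ℚ)` is the tree's `BettiUniverse.hodge exists_isReal_hodgeModel_holds hX 1` for any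
`hX : IsSmoothProjective n A.X` (as in `Pohlmann1968/SimpleCMAbelianVarietyHazamaCriterion`), its Mumford–Tate rank
`HodgeStructure.mtRank` (the dimension of the Mumford–Tate Lie algebra); the instance hypothesis
`[HodgeTensorFacts]` is the tree's convention for the tensor constructions behind `mtRank` (discharged by
`hodgeTensorFacts_holds`).  Theorems only; no definition, no named fact, no `sorry`; axioms `propext`,
`Classical.choice`, `Quot.sound`.

## References
* [Gordon1999HodgeAVSurvey] B. B. Gordon, *A survey of the Hodge conjecture for abelian varieties* (1999), 2.13,
  Thm. 6.4, 9.1, 9.4.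
* [Deligne1982HodgeCycles] P. Deligne, *Hodge cycles on abelian varieties*, LNM 900 (1982), I Example 3.7 (c).
* [Kubota1965] T. Kubota, *On the field extension by complex multiplication*, Trans. AMS 118 (1965), §2 (p. 115).
* [Milne1999] J. S. Milne, *Lefschetz motives and the Tate conjecture*, Compositio Math. 117 (1999), Prop. 2.5.
* [Shimura1998] G. Shimura, *Abelian Varieties with Complex Multiplication and Modular Functions* (1998), §6.1 Cor.
  (p. 41), §8.2 Prop. 26.
-/

noncomputable section

open CategoryTheory NumberField Module

namespace Literature.AlgebraicGeometry.ComplexMultiplication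

open scoped Manifold Classical nonZeroDivisors
open Literature.AlgebraicGeometry.Motives Literature.AlgebraicGeometry.HodgeTheory
open Literature.AlgebraicGeometry.Pohlmann1968 (IsNondegenerate cmTypeRank cmTypeRank_le isNondegenerate_iff)
open Literature.AlgebraicGeometry.Milne1999 (IsOfCMType)
open Literature.NumberTheory.ComplexMultiplication

namespace EndFieldFullDegree

variable {F : Type} [Field F] [NumberField F] {A : AbelianVariety ℂ}
  (ιF : F →+* A.endAlgebra) (hF : finrank ℚ F = 2 * A.dim) {n : ℕ} (hX : IsSmoothProjective n A.X)

include ιF hF in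
/-- **A pair `(A, ι : F →+* End_ℚ(A))` with `[F : ℚ] = 2 dim A` makes `A` an abelian variety of CM type** in Milne's
étale sense (`Milne1999.IsOfCMType`: `End_ℚ(A)` contains a commutative semisimple `ℚ`-algebra of degree `2 dim A`,
here the field `ι(F)`) — the tree's `isOfCMType_of_ringHom`, re-exported in the vocabulary of this lineage.
[cite: Milne1999, §2 p. 54 (abelian varieties of CM-type)] [cite: Shimura1998, §5.2 (p. 39)] -/
theorem isOfCMType : IsOfCMType A :=
  isOfCMType_of_ringHom ιF hF

variable [IsCMField F] [HodgeTensorFacts.{0, 0}]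

include hF in
/-- **Gordon 9.1 «`rank(K, S) = dim MT(A)`» (Pohlmann) for the pair, read on THE type**: for every complex abelian
variety `A` with a CM field `F ⊆ End_ℚ(A)` of degree `2 dim A`, the Mumford–Tate rank of the `ℚ`-Hodge structure
`H¹(A(ℂ); ℚ)` equals the rank `Rank(Φ)` (Kubota; the tree's `Pohlmann1968.cmTypeRank`) of THE type
`Φ = cmTypeOfPair ιF hF` — simple or not.  Route: `A ∼ A_Φ` (`isIsogenous_varietyOfIdeal_cmTypeOfPair`), the
Mumford–Tate rank of `H¹` is an isogeny invariant (`Pohlmann1968.mtRank_hodge_one_eq_of_isIsogenous`), and `A_Φ`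
carries a realisation of `Φ` for which `dim MT(H¹) = Rank(Φ)` (`HodgeStructure.mtRank_bettiHodge_eq_cmTypeRank'`,
Deligne I Ex. 3.7 (c)). [cite: Gordon1999HodgeAVSurvey, 9.1] [cite: Deligne1982HodgeCycles, I Example 3.7 (c)]
[cite: Shimura1998, §6.1 Cor., p. 41] -/
theorem mtRank_hodge_one_eq_cmTypeRank :
    haveI := BettiUniverse.finite hX 1
    (BettiUniverse.hodge exists_isReal_hodgeModel_holds hX 1).mtRank = cmTypeRank (cmTypeOfPair ιF hF) := by
  haveI := BettiUniverse.finite hX 1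
  obtain ⟨ι', θ', hB⟩ := CMTorusRealisation.exists_isCMTypeRealisation_varietyOfIdeal (cmTypeOfPair ιF hF)
    (1 : (FractionalIdeal (𝓞 F)⁰ F)ˣ)
  haveI := BettiUniverse.finite hB.1 1
  rw [Pohlmann1968.mtRank_hodge_one_eq_of_isIsogenous hX hB.1 (isIsogenous_varietyOfIdeal_cmTypeOfPair ιF hF)]
  exact HodgeStructure.mtRank_bettiHodge_eq_cmTypeRank' hB exists_isReal_hodgeModel_holds
    hodgePQ_independent_of_hodgeModel_holds

include ιF hF in
/-- **Kubota's bound for the pair: `dim MT(H¹(A)) ≤ dim A + 1`** («`rank (F; {φᵢ}) ≤ m + 1`»; `MT ⊆ L(A)`, Milne 1999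
Prop. 2.5; Gordon 2.13 `dim Hg(A) ≤ dim A`). [cite: Kubota1965, §2 (p. 115)] [cite: Milne1999, Prop. 2.5]
[cite: Gordon1999HodgeAVSurvey, 2.13 and 9.1] -/
theorem mtRank_hodge_one_le_dim_add_one :
    haveI := BettiUniverse.finite hX 1
    (BettiUniverse.hodge exists_isReal_hodgeModel_holds hX 1).mtRank ≤ A.dim + 1 := by
  have h := mtRank_hodge_one_eq_cmTypeRank ιF hF hX
  have hle := cmTypeRank_le (cmTypeOfPair ιF hF)
  have hdim : finrank ℚ F / 2 = A.dim := by omega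
  rw [hdim] at hle
  exact h ▸ hle

include ιF hF in
/-- **`dim MT(H¹(A)) = dim A + 1` iff THE type of `(A, ι)` is nondegenerate** (Gordon 9.4 «nondegenerate if
`rank(K, S) = dim A + 1`», 2.13 «`dim Hg(A) = dim A`»). [cite: Gordon1999HodgeAVSurvey, 9.4 and 2.13]
[cite: Kubota1965, §2 (p. 115)] -/
theorem mtRank_hodge_one_eq_dim_add_one_iff :
    haveI := BettiUniverse.finite hX 1
    (BettiUniverse.hodge exists_isReal_hodgeModel_holds hX 1).mtRank = A.dim + 1 ↔
      IsNondegenerate (cmTypeOfPair ιF hF) := by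
  have hdim : finrank ℚ F / 2 = A.dim := by omega
  rw [isNondegenerate_iff, hdim, mtRank_hodge_one_eq_cmTypeRank ιF hF hX]

include ιF hF hX in
/-- **Gordon Thm. 6.4 «`dim Hg(A) = dim A ⟹ Hdg(Aⁿ) = Div(Aⁿ)` for all `n`», WITHOUT the simplicity hypothesis**:
every complex abelian variety `A` with a CM field `F ⊆ End_ℚ(A)` of degree `2 dim A` and `dim MT(H¹(A)) = dim A + 1`
is stably nondegenerate (THE type is then nondegenerate, and `EndomorphismFieldNondegenerateType` applies to the
isotypic `A ∼ A_Φ`). [cite: Gordon1999HodgeAVSurvey, Thm. 6.4, 2.13 and §9.3] -/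
theorem isStablyNondegenerate_of_mtRank_hodge_one_eq
    (h : haveI := BettiUniverse.finite hX 1
      (BettiUniverse.hodge exists_isReal_hodgeModel_holds hX 1).mtRank = A.dim + 1) :
    IsStablyNondegenerate A :=
  isStablyNondegenerate_of_isNondegenerate_cmTypeOfPair ιF hF ((mtRank_hodge_one_eq_dim_add_one_iff ιF hF hX).1 h)

include ιF hF hX in
/-- **The Hodge conjecture for every power `A^{N+1}`** of a complex abelian variety `A` with a CM field of degree
`2 dim A` in `End_ℚ(A)` and `dim MT(H¹(A)) = dim A + 1`, UNCONDITIONAL. [cite: Gordon1999HodgeAVSurvey, Thm. 6.4 and §9.3]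
[cite: MoonenZarhin1999LowDim, §2 condition (D)] -/
theorem hodgeConjectureFor_powSucc_of_mtRank_hodge_one_eq
    (h : haveI := BettiUniverse.finite hX 1
      (BettiUniverse.hodge exists_isReal_hodgeModel_holds hX 1).mtRank = A.dim + 1) (N : ℕ) :
    HodgeConjectureFor (A.powSucc N).dim (A.powSucc N).X :=
  (isStablyNondegenerate_of_mtRank_hodge_one_eq ιF hF hX h).hodgeConjectureFor_powSucc N

include ιF hF in
/-- **HAZAMA'S CRITERION IN MUMFORD–TATE FORM for the pair (Gordon Thm. 6.4 verbatim): for a SIMPLE complex abelian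
variety `A` with a CM field `F ⊆ End_ℚ(A)` of degree `2 dim A`, `Hdg(Aⁿ) = Div(Aⁿ)` for all `n` iff
`dim MT(H¹(A)) = dim A + 1`** (i.e. `dim Hg(A) = dim A`).  The same statement on the carrier `Milne1999.IsOfCMType X`
is the tree's `Pohlmann1968.forall_isDivisorGenerated_powSucc_iff_mtRank_eq`; here it is read on THE type of the pair
through `isStablyNondegenerate_iff_isNondegenerate_cmTypeOfPair_of_isSimple`. [cite: Gordon1999HodgeAVSurvey, Thm. 6.4 and 9.1]
[cite: Shimura1998, §8.2 Prop. 26] -/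
theorem isStablyNondegenerate_iff_mtRank_hodge_one_eq_of_isSimple (hS : AbelianVariety.IsSimple A) :
    IsStablyNondegenerate A ↔
      haveI := BettiUniverse.finite hX 1
      (BettiUniverse.hodge exists_isReal_hodgeModel_holds hX 1).mtRank = A.dim + 1 := by
  rw [mtRank_hodge_one_eq_dim_add_one_iff ιF hF hX,
    isStablyNondegenerate_iff_isNondegenerate_cmTypeOfPair_of_isSimple ιF hF hS]

include ιF hF in
/-- **For a simple `A`: `dim MT(H¹(A)) ≠ dim A + 1` ⟹ an exceptional Hodge class on some power** (Gordon Thm. 6.4,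
the degenerate direction, on the pair: some `A^{N+1}` carries a rational `(m,m)` class outside `Dᵐ(A^{N+1}) ⊗ ℂ`).
[cite: Gordon1999HodgeAVSurvey, Thm. 6.4 and 9.5] -/
theorem exists_exceptional_powSucc_of_mtRank_hodge_one_ne (hS : AbelianVariety.IsSimple A)
    (h : haveI := BettiUniverse.finite hX 1
      (BettiUniverse.hodge exists_isReal_hodgeModel_holds hX 1).mtRank ≠ A.dim + 1) :
    ∃ (N m : ℕ) (c : complexBetti (A.powSucc N).X (2 * m)), IsRationalClass c ∧
      IsOfHodgeType (A.powSucc N).dim (A.powSucc N).X (2 * m) m m c ∧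
        c ∉ Literature.Barriers.HodgeConjecture.divisorClassesSpan (A.powSucc N).X (A.powSucc N).dim m := by
  have h' : ¬ IsStablyNondegenerate A :=
    fun hA => h ((isStablyNondegenerate_iff_mtRank_hodge_one_eq_of_isSimple ιF hF hX hS).1 hA)
  simp only [IsStablyNondegenerate, IsDivisorGenerated, not_forall] at h'
  obtain ⟨N, m, c, hcQ, hcH, hcD⟩ := h'
  exact ⟨N, m, c, hcQ, hcH, hcD⟩

include ιF hF hX in
/-- **Prime dimension / dimension `≤ 3`: `dim MT(H¹(A)) = dim A + 1` automatically** for a SIMPLE `A` with a CM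
field of degree `2 dim A` in `End_ℚ(A)` (Yanai 1985 / Ribet 1980 (3.7), through
`isStablyNondegenerate_of_prime` / `isStablyNondegenerate_of_dim_le_three` and Hazama's criterion).
[cite: Yanai1985, §4 Theorem and Remark (p. 172)] [cite: Ribet1980, §3 Examples (3.7) (p. 87)]
[cite: Gordon1999HodgeAVSurvey, Thm. 6.3 Remark and Thm. 6.4] -/
theorem mtRank_hodge_one_eq_dim_add_one_of_isSimple_of_prime_or_le_three (hS : AbelianVariety.IsSimple A)
    (h : A.dim.Prime ∨ A.dim ≤ 3) :
    haveI := BettiUniverse.finite hX 1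
    (BettiUniverse.hodge exists_isReal_hodgeModel_holds hX 1).mtRank = A.dim + 1 :=
  (isStablyNondegenerate_iff_mtRank_hodge_one_eq_of_isSimple ιF hF hX hS).1
    (h.elim (isStablyNondegenerate_of_prime ιF hF) (isStablyNondegenerate_of_dim_le_three ιF hF))

end EndFieldFullDegree

end Literature.AlgebraicGeometry.ComplexMultiplication

end
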